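import Summits.Ventures.QEC.Census.CertPopcount
import Summits.Ventures.QEC.Census.RankCert
import Summits.Ventures.QEC.Census.CertCheckBZAutSound
import HarnessLib

/-!
# Fast structural checks: `checkStructure` and `RankCert.check` with a fold-based popcount (rows `< 2^n`, `n ≤ 496`)

`Census/CertCheck.lean` (type-10) and `Census/RankCert.lean` (type-02) test parities and weights with
`CertBits.popc n x` — structural recursion on `n`. MEASURED in the kernel (`decide +kernel`, farm, 2026-08-27,
qec-search-7; FINDINGS §barriers B-5): one `popc n (h &&& v)` on real census rows costs ≈ 7 ms at `n = 180` but
≈ 0.36 s at `n = 200`, 0.46 s at `n = 224`, ≈ 1.2 s at `n = 288` (type-10 p477026: `upperOK 288 …`, ≈ 290 calls, 358 s);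
`checkStructure` and `RankCert.check` make `rows²` such calls, so census rows with `n ≥ 200` could not be certified.
This file gives drop-in FAST TWINS with the popcount computed by qec-search-10's byte-parallel fold
(`Census/CertPopcount.lean`: `popcFold B x = popc (8B) x` for `x < 2^(8B)`, `B ≤ 31`), applied to the two 248-bit
halves of a word (`popcQ`, exact for `x < 2^496`, ≈ 30 GMP-backed kernel operations whatever `n` is):

* `popcQ`, `popcQ_eq : x < 2^n → n ≤ 496 → popcQ x = popc n x`;
* `synZeroQ`, `commOKQ`, `upperOKQ`, `DistCert.checkStructureQ` (also checks every row / witness `< 2^n`) with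
  **`DistCert.checkStructure_of_checkStructureQ : c.n ≤ 496 → c.checkStructureQ = true → c.checkStructure = true`**;
* `RankCert.pivotsOKQ`, `RankCert.checkQ` (also checks the rows `< 2^n`) with
  **`RankCert.check_of_checkQ : n ≤ 496 → c.checkQ n H = true → c.check n H = true`**;
* controls: the `[[4,2,2]]` certificate and rank certificate through the twins (`decide`).

So every consumer theorem of the tree (`dZ_code_of_*`, `rank_rowMatrix_of_check`, `isCode_*`) applies verbatim after
one application of the bridge. Generic; axioms standard; no `native_decide`.
-/

namespace Summit.Ventures.QEC.Census

/-! ## The fold popcount on up to 496 bits -/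

/-- Popcount of a word `< 2^496`: byte-parallel fold (`popcFold 31`) of the low and of the high 248 bits. (definition) -/
def popcQ (x : ℕ) : ℕ := popcFold 31 (x % 2 ^ (8 * 31)) + popcFold 31 (x / 2 ^ (8 * 31))

/-- `popc` does not see bits the word does not have: for `x < 2^n ≤ 2^m`, `popc m x = popc n x`. -/
theorem popc_eq_of_lt {n m x : ℕ} (hx : x < 2 ^ n) (hnm : n ≤ m) : popc m x = popc n x := by
  obtain ⟨a, rfl⟩ := Nat.exists_eq_add_of_le hnm
  rw [Nat.add_comm, popc_add a n x, Nat.div_eq_of_lt hx, popc_zero, Nat.add_zero]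

set_option exponentiation.threshold 512 in
/-- **The fold popcount is `popc n`** on words `< 2^n`, `n ≤ 496`. -/
theorem popcQ_eq {n x : ℕ} (hx : x < 2 ^ n) (hn : n ≤ 496) : popcQ x = popc n x := by
  have hn' : n ≤ 8 * 31 + 8 * 31 := by omega
  rw [← popc_eq_of_lt hx hn']
  have hlo : x % 2 ^ (8 * 31) < 2 ^ (8 * 31) := Nat.mod_lt _ (Nat.two_pow_pos _)
  have hhi : x / 2 ^ (8 * 31) < 2 ^ (8 * 31) := by
    rw [Nat.div_lt_iff_lt_mul (Nat.two_pow_pos _), ← Nat.pow_add]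
    exact lt_of_lt_of_le hx (Nat.pow_le_pow_right Nat.two_pos hn')
  unfold popcQ
  rw [popcFold_eq_popc (le_refl _) hlo, popcFold_eq_popc (le_refl _) hhi, popc_add (8 * 31) (8 * 31) x]
  have hmod : popc (8 * 31) (x % 2 ^ (8 * 31)) = popc (8 * 31) x := by
    conv_rhs => rw [← Nat.mod_add_div x (2 ^ (8 * 31))]
    rw [popc_add_mul_two_pow]
  rw [hmod]

/-! ## Fast twins of the structural words of `CertCheck` -/

/-- `synZero` with the fold popcount: every row of `H` has even overlap with `v`. (definition) -/
def synZeroQ (H : List ℕ) (v : ℕ) : Bool := H.all fun h => popcQ (h &&& v) % 2 == 0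

/-- `commOK` with the fold popcount. (definition) -/
def commOKQ (HX HZ : List ℕ) : Bool := HX.all fun hx => synZeroQ HZ hx

/-- `upperOK` with the fold popcount (the witness `v` must be `< 2^n`, checked). (definition) -/
def upperOKQ (n : ℕ) (Hsyn Hstab : List ℕ) (d v u : ℕ) : Bool :=
  decide (v < 2 ^ n) && synZeroQ Hsyn v && (popcQ v == d) && synZeroQ Hstab u && (popcQ (u &&& v) % 2 == 1)

/-- Rows bounded by `2^n`. (definition) -/
def rowsLt (n : ℕ) (H : List ℕ) : Bool := H.all fun h => decide (h < 2 ^ n)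

section Bridges

variable {n : ℕ}

/-- Fast `synZero` ⇒ `synZero`, for rows `< 2^n`. -/
theorem synZero_of_synZeroQ {H : List ℕ} {v : ℕ} (hH : rowsLt n H = true) (hn : n ≤ 496)
    (h : synZeroQ H v = true) : synZero n H v = true := by
  simp only [rowsLt, synZeroQ, synZero, List.all_eq_true, decide_eq_true_eq, beq_iff_eq] at hH h ⊢
  intro x hx
  rw [← popcQ_eq (lt_of_le_of_lt Nat.and_le_left (hH x hx)) hn]
  exact h x hx

/-- Fast `commOK` ⇒ `commOK`. -/
theorem commOK_of_commOKQ {HX HZ : List ℕ} (hZ : rowsLt n HZ = true) (hn : n ≤ 496)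
    (h : commOKQ HX HZ = true) : commOK n HX HZ = true := by
  simp only [commOKQ, commOK, List.all_eq_true] at h ⊢
  exact fun hx hhx => synZero_of_synZeroQ hZ hn (h hx hhx)

/-- Fast `upperOK` ⇒ `upperOK`. -/
theorem upperOK_of_upperOKQ {Hsyn Hstab : List ℕ} {d v u : ℕ} (hsyn : rowsLt n Hsyn = true)
    (hstab : rowsLt n Hstab = true) (hn : n ≤ 496) (h : upperOKQ n Hsyn Hstab d v u = true) :
    upperOK n Hsyn Hstab d v u = true := by
  simp only [upperOKQ, Bool.and_eq_true, decide_eq_true_eq, beq_iff_eq] at h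
  obtain ⟨⟨⟨⟨hv, h1⟩, h2⟩, h3⟩, h4⟩ := h
  simp only [upperOK, Bool.and_eq_true, beq_iff_eq]
  refine ⟨⟨⟨synZero_of_synZeroQ hsyn hn h1, ?_⟩, synZero_of_synZeroQ hstab hn h3⟩, ?_⟩
  · rw [← popcQ_eq hv hn]; exact h2
  · rw [← popcQ_eq (lt_of_le_of_lt Nat.and_le_right hv) hn]; exact h4

end Bridges

namespace DistCert

variable (c : DistCert)

/-- **Fast structural check of a distance certificate**: rows and witnesses `< 2^n`, then `checkStructure` with the
fold popcount (commutation, both upper witnesses, both allow-list decompositions). (definition) -/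
def checkStructureQ : Bool :=
  rowsLt c.n c.HX && rowsLt c.n c.HZ && commOKQ c.HX c.HZ &&
    upperOKQ c.n c.HX c.HZ c.sideZ.d c.sideZ.witness c.sideZ.nonmember && foundOK c.HZ c.sideZ.found &&
    upperOKQ c.n c.HZ c.HX c.sideX.d c.sideX.witness c.sideX.nonmember && foundOK c.HX c.sideX.found

/-- **Bridge**: the fast structural check implies type-10's `checkStructure` (for `n ≤ 496`). -/
theorem checkStructure_of_checkStructureQ (hn : c.n ≤ 496) (h : c.checkStructureQ = true) :
    c.checkStructure = true := by
  simp only [checkStructureQ, Bool.and_eq_true] at h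
  obtain ⟨⟨⟨⟨⟨⟨hX, hZ⟩, hc⟩, huZ⟩, hfZ⟩, huX⟩, hfX⟩ := h
  simp only [checkStructure, Bool.and_eq_true]
  exact ⟨⟨⟨⟨commOK_of_commOKQ hZ hn hc, upperOK_of_upperOKQ hX hZ hn huZ⟩, hfZ⟩,
    upperOK_of_upperOKQ hZ hX hn huX⟩, hfX⟩

end DistCert

/-! ## Fast twin of the rank-certificate checker -/

namespace RankCert

/-- The pivot block checks with the fold popcount. (definition) -/
def pivotsOKQ (H : List ℕ) (c : RankCert) : Bool :=
  (c.pivots.length == c.r) && (c.rinv.length == c.r) && c.pivots.all (fun p => decide (p < H.length)) &&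
    (List.range c.r).all fun a => (List.range c.r).all fun i =>
      popcQ (H.getD (c.pivots.getD a 0) 0 &&& c.rinv.getD i 0) % 2 == (if a = i then 1 else 0)

/-- **Fast rank-certificate checker**: rows `< 2^n`, fast pivot block, and the (popcount-free) row decompositions. -/
def checkQ (n : ℕ) (H : List ℕ) (c : RankCert) : Bool :=
  rowsLt n H && c.pivotsOKQ H && (List.range H.length).all (c.rowOK H)

/-- `H.getD p 0 < 2^n` when every row is. -/
private theorem getD_lt {n : ℕ} {H : List ℕ} (hH : rowsLt n H = true) (p : ℕ) : H.getD p 0 < 2 ^ n := by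
  simp only [rowsLt, List.all_eq_true, decide_eq_true_eq] at hH
  rw [List.getD_eq_getElem?_getD]
  cases h : H[p]? with
  | none => simp
  | some x => simpa using hH x (List.mem_of_getElem? h)

/-- **Bridge**: the fast rank-certificate check implies type-02's `RankCert.check` (for `n ≤ 496`). -/
theorem check_of_checkQ {n : ℕ} {H : List ℕ} {c : RankCert} (hn : n ≤ 496) (h : c.checkQ n H = true) :
    c.check n H = true := by
  simp only [checkQ, Bool.and_eq_true] at h
  obtain ⟨⟨hH, hp⟩, hrows⟩ := h
  simp only [check, Bool.and_eq_true]
  refine ⟨?_, hrows⟩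
  simp only [pivotsOKQ, Bool.and_eq_true, List.all_eq_true, beq_iff_eq] at hp
  obtain ⟨hlen, htab⟩ := hp
  simp only [pivotsOK, Bool.and_eq_true, List.all_eq_true, beq_iff_eq]
  refine ⟨hlen, fun a ha i hi => ?_⟩
  rw [← popcQ_eq (lt_of_le_of_lt Nat.and_le_left (getD_lt hH _)) hn]
  exact htab a ha i hi

end RankCert

/-! ## Controls (CERT-REQS A1): `[[4,2,2]]` through the fast twins -/

/-- The `[[4,2,2]]` certificate passes the fast structural check (`decide`). -/
theorem checkStructureQ_certC422 : certC422.checkStructureQ = true := by decide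

/-- The `[[4,2,2]]` rank certificate passes the fast checker (`decide`). -/
theorem checkQ_rankCertC422 : rankCertC422.checkQ 4 [15] = true := by decide

/-- … hence, through the two bridges, the structural check AND the rank check of `[[4,2,2]]` (conjoined: the separate
statements are already in the tree by `decide`). -/
theorem checks_certC422_of_Q : certC422.checkStructure = true ∧ rankCertC422.check 4 [15] = true :=
  ⟨certC422.checkStructure_of_checkStructureQ (by decide) checkStructureQ_certC422,
   RankCert.check_of_checkQ (by decide) checkQ_rankCertC422⟩

/-- Negative control: a witness that is not `< 2^n` is rejected by the fast check (here `v = 16 ≥ 2^4`). -/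
theorem upperOKQ_neg : upperOKQ 4 [15] [15] 1 16 1 = false := by decide

/-! ## Appendix (qec-search-7 g2, 2026-08-27): fast twins of `logOK` and of `bzCoreOK` (the core of the `bz_aut` lanes) -/

/-- `logOK` with the fold popcount: `|L| = |Ld|`, every `L` word has zero `Hsyn`-syndrome, every `Ld` word zero
`Hstab`-syndrome, and the pairing table `⟨L_i, Ld_j⟩ ≡ [i = j]`; words must be `< 2^n` (checked). (definition) -/
def logOKQ (n : ℕ) (Hsyn Hstab L Ld : List ℕ) : Bool :=
  rowsLt n L && rowsLt n Ld && (L.length == Ld.length) && (L.all fun l => synZeroQ Hsyn l) &&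
    (Ld.all fun l => synZeroQ Hstab l) &&
    ((List.range L.length).all fun i => (List.range L.length).all fun j =>
      popcQ (L.getD i 0 &&& Ld.getD j 0) % 2 == if i = j then 1 else 0)

/-- `L.getD i 0 < 2^n` when every word of `L` is. -/
private theorem getD_lt' {n : ℕ} {L : List ℕ} (hL : rowsLt n L = true) (i : ℕ) : L.getD i 0 < 2 ^ n := by
  simp only [rowsLt, List.all_eq_true, decide_eq_true_eq] at hL
  rw [List.getD_eq_getElem?_getD]
  cases h : L[i]? with
  | none => simp
  | some x => simpa using hL x (List.mem_of_getElem? h)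

/-- **Bridge**: the fast pairing check implies `logOK` (type-10 `Census/CertLogical.lean`), for rows `< 2^n`, `n ≤ 496`. -/
theorem logOK_of_logOKQ {n : ℕ} {Hsyn Hstab L Ld : List ℕ} (hsyn : rowsLt n Hsyn = true)
    (hstab : rowsLt n Hstab = true) (hn : n ≤ 496) (h : logOKQ n Hsyn Hstab L Ld = true) :
    logOK n Hsyn Hstab L Ld = true := by
  simp only [logOKQ, Bool.and_eq_true, List.all_eq_true, beq_iff_eq] at h
  obtain ⟨⟨⟨⟨⟨hL, hLd⟩, hlen⟩, hsL⟩, hsLd⟩, htab⟩ := h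
  simp only [logOK, Bool.and_eq_true, List.all_eq_true, beq_iff_eq]
  refine ⟨⟨⟨hlen, fun l hl => synZero_of_synZeroQ hsyn hn (hsL l hl)⟩,
    fun l hl => synZero_of_synZeroQ hstab hn (hsLd l hl)⟩, fun i hi j hj => ?_⟩
  rw [← popcQ_eq (lt_of_le_of_lt Nat.and_le_left (getD_lt' hL i)) hn]
  exact htab i hi j hj

/-- `bzCoreOK` (type-10 `Census/CertCheckBZAutSound.lean`: the two rank certificates, the logical pairing, the dimension
identity, the parity witness) with the fold popcount everywhere, plus the row bounds it needs. (definition) -/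
def bzCoreOKQ (n : ℕ) (Hsyn Hstab : List ℕ) (rcY rcS : RankCert) (L Ld : List ℕ) (ew : Option (List ℕ)) : Bool :=
  rcY.checkQ n Hsyn && rcS.checkQ n Hstab && logOKQ n Hsyn Hstab L Ld && (n == rcY.r + rcS.r + L.length) &&
    parityPartOK n Hsyn ew

/-- **Bridge**: the fast core check implies `bzCoreOK` (for `n ≤ 496`). -/
theorem bzCoreOK_of_bzCoreOKQ {n : ℕ} {Hsyn Hstab : List ℕ} {rcY rcS : RankCert} {L Ld : List ℕ}
    {ew : Option (List ℕ)} (hn : n ≤ 496) (h : bzCoreOKQ n Hsyn Hstab rcY rcS L Ld ew = true) :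
    bzCoreOK n Hsyn Hstab rcY rcS L Ld ew = true := by
  simp only [bzCoreOKQ, Bool.and_eq_true] at h
  obtain ⟨⟨⟨⟨hY, hS⟩, hlog⟩, hdim⟩, hpar⟩ := h
  have hsyn : rowsLt n Hsyn = true := by
    simp only [RankCert.checkQ, Bool.and_eq_true] at hY; exact hY.1.1
  have hstab : rowsLt n Hstab = true := by
    simp only [RankCert.checkQ, Bool.and_eq_true] at hS; exact hS.1.1
  simp only [bzCoreOK, Bool.and_eq_true]
  exact ⟨⟨⟨⟨RankCert.check_of_checkQ hn hY, RankCert.check_of_checkQ hn hS⟩,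
    logOK_of_logOKQ hsyn hstab hn hlog⟩, hdim⟩, hpar⟩

/-- Control: the Steane `bz` certificate's core (type-10 `bzSteane`, `Census/CertCheckBZ.lean`) through the fast twin. -/
theorem bzCoreOKQ_steane :
    bzCoreOKQ 7 certSteane7.HX certSteane7.HZ bzSteane.rcX bzSteane.rcZ bzSteane.LZ bzSteane.LX
      bzSteane.sideZ.evenWitness = true := by
  decide

/-- … hence `bzCoreOK` for it, through the bridge. -/
theorem bzCoreOK_steane_of_Q :
    bzCoreOK 7 certSteane7.HX certSteane7.HZ bzSteane.rcX bzSteane.rcZ bzSteane.LZ bzSteane.LX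
      bzSteane.sideZ.evenWitness = true :=
  bzCoreOK_of_bzCoreOKQ (by decide) bzCoreOKQ_steane

end Summit.Ventures.QEC.Census
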